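import Summits.QuantumFields.YangMills.Theorems.AllWindowsColdBoxBoxHighLineChartGaussianTail

/-!
# T-S5.6 inputs (6d, chart letters, continued): integrability of the chart Gaussian, its mass on the small-field box from below, and the
# mass ratio between two inverse temperatures (the `((1+ε)/(1−ε))^{3n/2} = e^{O(rH⁵)}` sandwich loss)
# (STUB-PLAN-S5-STEP2 §5 T-S5.6 `SmallFieldInsideFP`, planner ym-idea-2 g18 19:07:07Z «denominators compared on smallField(s/2) … the e^{CrH⁵} is the global
# sandwich loss (1−ε)^{−n/2}»; LINE-19 S5 ⟨stmt-QuantumFields-24004⟩/⟨24335⟩, LINE-20 U5 ⟨24336⟩)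

Width seat `ym-line-sfw-p2-w4` (prover-ym-line-sfw-p2-w4-g27-0).  Over ✓`…ChartGaussianTail`:
* `integrable_exp_neg_mul_boxQuadForm` — `a ↦ e^{−β′·boxQuadForm H a}` is integrable (`β′ > 0`; flattened Gaussian);
* `integral_exp_neg_mul_boxQuadForm_pos` — its mass is `> 0`;
* **`le_setIntegral_smallField_exp`** — DENOMINATOR: `(1 − 6·|LandauFree H|·e^{−β′t²/(3C₃)})·∫ e^{−β′Q} ≤ ∫_{smallField H t} e^{−β′Q}` (`t ≥ 0`; the tail lemma at `t` and
  `∫_S + ∫_{Sᶜ} = ∫`);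
* **`integral_exp_neg_mul_boxQuadForm_eq_mul`** — MASS RATIO: `∫ e^{−β″Q} = (β′/β″)^{|LandauFree H × Fin 3|/2} · ∫ e^{−β′Q}` for `β′, β″ > 0`, i.e. the exact
  sandwich loss between the precisions `β(1∓ε)`; with `|LandauFree H × Fin 3| = 3n ≲ H⁴` and `β′/β″ = (1+ε)/(1−ε)`, `ε = C·r·H`, this is the factor `e^{O(rH⁵)}` of T-S5.6.

Everything proved; no definitions; standard axioms.  HONEST LABEL: inputs of the OPEN task T-S5.6 of STEP 2 of the XL stub S5 of a critic-PASSed DRAFT line on the R2ξ″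
cruxes; T-S5.6, S5, U5 and the items ⟨24004⟩ ⟨24335⟩ ⟨24336⟩ remain OPEN; no stub is closed by name, no crux, rung or summit is proved; the Yang–Mills mass gap is
NOT proved by this file.
-/

set_option autoImplicit false

open MeasureTheory Matrix Finset Real
open scoped Kronecker

namespace Summit.QuantumFields.YangMills.Theorems.AllWindowsColdBoxBoxHighLine

namespace ChartGauss

open LaplaceSandwich GaussianChartWick

variable {H : ℕ}

/-- **The chart Gaussian is integrable** (`β′ > 0`). -/
theorem integrable_exp_neg_mul_boxQuadForm {β' : ℝ} (hβ : 0 < β') :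
    Integrable fun a : LandauFree H → E3 => Real.exp (-(β' * boxQuadForm H a)) := by
  have hfi := Literature.MathematicalPhysics.QuantumFieldTheory.Balaban1983to89.Beta.GaussianIntegral.integrable_exp_neg_half_quadForm _
    (posDef_precision (H := H) hβ)
  have h := ((volume_preserving_flatten (LandauFree H)).integrable_comp_emb (flatten (LandauFree H)).measurableEmbedding).2 hfi
  refine h.congr (ae_of_all _ fun a => ?_)
  simp only [Function.comp_apply, neg_mul_boxQuadForm_eq]

/-- The chart Gaussian mass is positive. -/
theorem integral_exp_neg_mul_boxQuadForm_pos {β' : ℝ} (hβ : 0 < β') :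
    0 < ∫ a : LandauFree H → E3, Real.exp (-(β' * boxQuadForm H a)) := by
  rw [integral_exp_neg_mul_boxQuadForm hβ]
  exact div_pos (pow_pos (Real.sqrt_pos.2 (by positivity)) _) (Real.sqrt_pos.2 (posDef_precision (H := H) hβ).det_pos)

/-- **DENOMINATOR of T-S5.6**: the chart Gaussian mass of the small-field box from below,
`(1 − 6·|LandauFree H|·e^{−β′t²/(3C₃)})·∫ e^{−β′Q} ≤ ∫_{smallField H t} e^{−β′Q}`. -/
theorem le_setIntegral_smallField_exp {β' t C₃ : ℝ} (hβ : 0 < β') (ht : 0 ≤ t) (hC₃ : 0 < C₃)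
    (hvar : ∀ e : LandauFree H, (hodgeQ H)⁻¹ e e ≤ C₃) :
    (1 - 6 * Fintype.card (LandauFree H) * Real.exp (-(β' * t ^ 2 / (3 * C₃)))) *
        ∫ a : LandauFree H → E3, Real.exp (-(β' * boxQuadForm H a)) ≤
      ∫ a in smallField H t, Real.exp (-(β' * boxQuadForm H a)) := by
  have htail := setIntegral_compl_smallField_exp_le (H := H) hβ ht hC₃ hvar
  have hsplit := integral_add_compl (measurableSet_smallField (H := H) t) (integrable_exp_neg_mul_boxQuadForm (H := H) hβ)
  -- `∫_S = ∫ − ∫_{Sᶜ} ≥ ∫ − 6n·e·∫`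
  rw [sub_mul, one_mul]
  linarith

/-- **MASS RATIO between two inverse temperatures**: `∫ e^{−β″Q} = (β′/β″)^{|ι|/2}·∫ e^{−β′Q}` (`ι = LandauFree H × Fin 3`; exact). -/
theorem integral_exp_neg_mul_boxQuadForm_eq_mul {β' β'' : ℝ} (hβ' : 0 < β') (hβ'' : 0 < β'') :
    ∫ a : LandauFree H → E3, Real.exp (-(β'' * boxQuadForm H a)) =
      Real.sqrt (β' / β'') ^ Fintype.card (LandauFree H × Fin 3) * ∫ a : LandauFree H → E3, Real.exp (-(β' * boxQuadForm H a)) := by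
  rw [integral_exp_neg_mul_boxQuadForm hβ', integral_exp_neg_mul_boxQuadForm hβ'', Matrix.det_smul, Matrix.det_smul]
  set n := Fintype.card (LandauFree H × Fin 3) with hn
  have hDpos : 0 < (hodgeQ H ⊗ₖ (1 : Matrix (Fin 3) (Fin 3) ℝ)).det := (posDef_kronecker_one (hodgeQ H) (hodgeQ_posDef H)).det_pos
  have hsq : ∀ {c : ℝ}, 0 < c → Real.sqrt (c ^ n) = Real.sqrt c ^ n := by
    intro c hc
    have h2 : (Real.sqrt c ^ n) ^ 2 = c ^ n := by rw [← pow_mul, mul_comm n 2, pow_mul, Real.sq_sqrt hc.le]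
    rw [← h2, Real.sqrt_sq (pow_nonneg (Real.sqrt_nonneg _) _)]
  have hs'' : 0 < Real.sqrt (2 * β'') := Real.sqrt_pos.2 (by positivity)
  have hs' : 0 < Real.sqrt (2 * β') := Real.sqrt_pos.2 (by positivity)
  have hM' : 0 < Real.sqrt (hodgeQ H ⊗ₖ (1 : Matrix (Fin 3) (Fin 3) ℝ)).det := Real.sqrt_pos.2 hDpos
  have hratio : Real.sqrt (β' / β'') = Real.sqrt (2 * β') / Real.sqrt (2 * β'') := by
    rw [← Real.sqrt_div' _ (by positivity : (0:ℝ) ≤ 2 * β'')]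
    congr 1
    field_simp
  rw [Real.sqrt_mul (pow_nonneg (by positivity) _), Real.sqrt_mul (pow_nonneg (by positivity) _),
    hsq (by positivity : (0:ℝ) < 2 * β''), hsq (by positivity : (0:ℝ) < 2 * β'), hratio, div_pow]
  field_simp

end ChartGauss

end Summit.QuantumFields.YangMills.Theorems.AllWindowsColdBoxBoxHighLine
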